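import Summits.CriticalPhenomena.Ising3D.TaylorRegionQPoly
import Summits.CriticalPhenomena.Ising3D.TaylorCertificateTermwise
import Mathlib.Tactic.Linarith
import Mathlib.Tactic.Positivity
import Mathlib.Tactic.Ring
import HarnessLib

/-!
# The odd-sector term value of a derivative certificate at `(½,½)`: polynomial up to ONE factor `2^{-(Δε-Δσ)}`
(cell `pub-ising3x`, seat boot-1; gate (g2)/(g3), odd sector: what the exact producer / rational checker decides)

HONEST FRAMING: lottery ticket; floor = tightest certified 3D Ising CFT bounds; no exact-solution
claim without a proof.

For `α = taylorCrossing ½ ½ S w` and an odd-sector term `(n,j)` at `(Δ, ℓ)`: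
`oddTermValue α Δσ Δε Δ ℓ (n,j) = (½)^{2Δσ} (½)^{Δ+n} · [(-1)^ℓ c₋ κ q̂₃ + c₊ (q̂₄ - q̂₅)]` (`oddTermValue_half_eq`),
`κ = (½)^{Δε-Δσ}` (the ONE non-algebraic number, from the different prefactor exponents of rule 3,
`s = (Δσ+Δε)/2`, and rules 4–5, `s = Δσ`), `c₋ = A_{n,j}(-t/2,t/2)/λ_ℓ`, `c₊ = A_{n,j}(t/2,t/2)/λ_ℓ` (`t = Δσ-Δε`;
rational functions of `(Δ, t)` for fixed `(ℓ,n,j)` by the Dolan–Osborn recursion), `q̂₃ = qSum (w 2) S s (-1) (Δ+n) j`,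
`q̂₄ = qSum (w 3) S Δσ (-1) (Δ+n) j`, `q̂₅ = qSum (w 4) S Δσ 1 (Δ+n) j`. Hence `oddTermValue ≥ 0 ↔ bracket ≥ 0`
(`oddTermValue_half_nonneg_iff`): a certificate bounds `κ` by a rational interval over the box and checks a
polynomial inequality. Sources: Kos–Poland–Simmons-Duffin 2014 §3.2 eq. (3.13); Dolan–Osborn 2004 §3.
-/

namespace Summit.CriticalPhenomena.Ising3D

open Finset Set
open Literature.MathematicalPhysics.QuantumFieldTheory.ConformalBootstrap3D

/-- **The odd term value at `(½,½)`, factorised.** For `j ≤ Δ + n`: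
`oddTermValue = (½)^{2Δσ} (½)^{Δ+n} [(-1)^ℓ c₋ (½)^{Δε-Δσ} q̂₃ + c₊ (q̂₄ - q̂₅)]`. [cite: KosPolandSimmonsduffin2014, §3.2 eq. (3.13)] -/
theorem oddTermValue_half_eq (S : Finset (ℕ × ℕ)) (w : Fin 5 → ℕ × ℕ → ℝ) (Δσ Δε Δ : ℝ) (ℓ : ℕ)
    (q : ℕ × ℕ) (hj : (q.2 : ℝ) ≤ Δ + (q.1 : ℝ)) :
    oddTermValue (taylorCrossing (1 / 2) (1 / 2) S w) Δσ Δε Δ ℓ q =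
      (1 / 2 : ℝ) ^ (2 * Δσ) * (1 / 2 : ℝ) ^ (Δ + (q.1 : ℝ)) *
        ((-1 : ℝ) ^ ℓ * (hrCoeffAB (-(Δσ - Δε) / 2) ((Δσ - Δε) / 2) Δ ℓ q.1 q.2 / legendreLam ℓ) *
            ((1 / 2 : ℝ) ^ (Δε - Δσ) * qSum (w 2) S ((Δσ + Δε) / 2) (-1) (Δ + (q.1 : ℝ)) q.2) +
          hrCoeffAB ((Δσ - Δε) / 2) ((Δσ - Δε) / 2) Δ ℓ q.1 q.2 / legendreLam ℓ *
            (qSum (w 3) S Δσ (-1) (Δ + (q.1 : ℝ)) q.2 - qSum (w 4) S Δσ 1 (Δ + (q.1 : ℝ)) q.2)) := by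
  have h0 : (0 : ℝ) < 1 / 2 := by norm_num
  have e3 : (taylorCrossing (1 / 2) (1 / 2) S w).α₃ (crossF ((Δσ + Δε) / 2) (-1) (zMono (Δ + (q.1 : ℝ)) q.2))
      = (1 / 2 : ℝ) ^ (2 * ((Δσ + Δε) / 2)) * (1 / 2 : ℝ) ^ (Δ + (q.1 : ℝ)) *
        qSum (w 2) S ((Δσ + Δε) / 2) (-1) (Δ + (q.1 : ℝ)) q.2 :=
    sum_smul_taylorCoeffAt_crossF_zMono_half _ _ _ _ _ _ hj
  have e4 : (taylorCrossing (1 / 2) (1 / 2) S w).α₄ (crossF Δσ (-1) (zMono (Δ + (q.1 : ℝ)) q.2))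
      = (1 / 2 : ℝ) ^ (2 * Δσ) * (1 / 2 : ℝ) ^ (Δ + (q.1 : ℝ)) * qSum (w 3) S Δσ (-1) (Δ + (q.1 : ℝ)) q.2 :=
    sum_smul_taylorCoeffAt_crossF_zMono_half _ _ _ _ _ _ hj
  have e5 : (taylorCrossing (1 / 2) (1 / 2) S w).α₅ (crossF Δσ 1 (zMono (Δ + (q.1 : ℝ)) q.2))
      = (1 / 2 : ℝ) ^ (2 * Δσ) * (1 / 2 : ℝ) ^ (Δ + (q.1 : ℝ)) * qSum (w 4) S Δσ 1 (Δ + (q.1 : ℝ)) q.2 :=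
    sum_smul_taylorCoeffAt_crossF_zMono_half _ _ _ _ _ _ hj
  have hsplit : (1 / 2 : ℝ) ^ (2 * ((Δσ + Δε) / 2)) = (1 / 2 : ℝ) ^ (2 * Δσ) * (1 / 2 : ℝ) ^ (Δε - Δσ) := by
    rw [← Real.rpow_add h0]; congr 1; ring
  unfold oddTermValue
  rw [e3, e4, e5, hsplit]
  ring

/-- **Sign test**: `oddTermValue ≥ 0 ↔` the bracket `≥ 0` (the prefactor is positive).
[cite: KosPolandSimmonsduffin2014, §3.3 eq. (3.16)] -/
theorem oddTermValue_half_nonneg_iff (S : Finset (ℕ × ℕ)) (w : Fin 5 → ℕ × ℕ → ℝ) (Δσ Δε Δ : ℝ)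
    (ℓ : ℕ) (q : ℕ × ℕ) (hj : (q.2 : ℝ) ≤ Δ + (q.1 : ℝ)) :
    0 ≤ oddTermValue (taylorCrossing (1 / 2) (1 / 2) S w) Δσ Δε Δ ℓ q ↔
      0 ≤ (-1 : ℝ) ^ ℓ * (hrCoeffAB (-(Δσ - Δε) / 2) ((Δσ - Δε) / 2) Δ ℓ q.1 q.2 / legendreLam ℓ) *
            ((1 / 2 : ℝ) ^ (Δε - Δσ) * qSum (w 2) S ((Δσ + Δε) / 2) (-1) (Δ + (q.1 : ℝ)) q.2) +
          hrCoeffAB ((Δσ - Δε) / 2) ((Δσ - Δε) / 2) Δ ℓ q.1 q.2 / legendreLam ℓ *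
            (qSum (w 3) S Δσ (-1) (Δ + (q.1 : ℝ)) q.2 - qSum (w 4) S Δσ 1 (Δ + (q.1 : ℝ)) q.2) := by
  rw [oddTermValue_half_eq S w Δσ Δε Δ ℓ q hj]
  have h0 : (0 : ℝ) < 1 / 2 := by norm_num
  have hP : 0 < (1 / 2 : ℝ) ^ (2 * Δσ) * (1 / 2 : ℝ) ^ (Δ + (q.1 : ℝ)) :=
    mul_pos (Real.rpow_pos_of_pos h0 _) (Real.rpow_pos_of_pos h0 _)
  exact mul_nonneg_iff_of_pos_left hP

/-- In the descendant range at an admissible `(Δ, ℓ)` the hypothesis `j ≤ Δ + n` holds. [folklore] -/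
theorem cast_le_add_of_inDescendantRange {Δ : ℝ} {ℓ : ℕ} (hℓΔ : (ℓ : ℝ) ≤ Δ) {q : ℕ × ℕ}
    (hq : InDescendantRange ℓ q.1 q.2) : (q.2 : ℝ) ≤ Δ + (q.1 : ℝ) := by
  have h2 : q.2 ≤ ℓ + q.1 := hq.2.1
  have : (q.2 : ℝ) ≤ ℓ + q.1 := by exact_mod_cast h2
  linarith

end Summit.CriticalPhenomena.Ising3D
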